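import Summits.HubbardSuperconductivity.HubbardSuperconductivity.Theorems.AnisotropyChordGroundProjectionLimit
import Summits.HubbardSuperconductivity.HubbardSuperconductivity.Theorems.AnisotropyChordOccupationStablePairs

/-!
# Route `AnisotropyChord`: THEOREM T-INT HOLDS — `XXZTowerProperPosition` is a tree theorem
# (adjacent-sector XXZ ground states are in proper position, every finite connected graph, `Δ ∈ [−1,1]`)

The theory seat's THEOREM T-INT (tower interlacing; memo ROTOR-THEORY-6 §65; typed in
`…RealStabilityDefs` as `XXZTowerProperPosition`, tagged «proved on paper, Lean proof pending the
Borcea–Brändén facts (Thm 1.6)») is PROVED here WITHOUT any new Literature fact, from tree theorems only: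

1. **Initial pair.**  In the occupation convention of the BEC line (`1⁰_S` = value `0` on `S`, `1` off
   `S`) the weight-`k` indicator `𝟙_k` has occupation polynomial `e_{n−k}(z)` (`occ_ind_eq_esymm`), and
   `𝟙_W + u·𝟙_{W+1}` has `e_{n−W}(z) + u·e_{n−W−1}(z) = e_{n−W}(z, u)`, the elementary symmetric
   polynomial of the `n+1` variables `(z, u)` — non-zero on `ℍ^{n+1}` by the tree's
   `Literature.Combinatorics.StablePolynomials.isUpperHalfPlaneStable_esymm` (`occ_indPair_ne_zero`).
   So no Hermite–Kakeya–Obreschkoff / «consecutive coefficients» lemma is needed: the spectator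
   variable `u` is a genuine `(n+1)`-st variable of an elementary symmetric polynomial.
2. **Flow.**  S2 (`xxz_gibbs_preserves_occStable`, exported in `…AmplitudeStableHolds` from the BEC
   line's landed stubs): for every `u ∈ ℍ` and `t ≥ 0`, `e^{−tH}𝟙_W + u·e^{−tH}𝟙_{W+1}` has a stable
   occupation polynomial; positive rescaling of the two members keeps this (`u ↦ u·e^{t(E_{W+1}−E_W)}`).
3. **Sectorwise power method.**  `e^{tE_W} e^{−tH} 𝟙_W → a`, `e^{tE_{W+1}} e^{−tH} 𝟙_{W+1} → b`, non-zero
   sector ground vectors (`groundProjection_of_groundOverlap` of `…GroundProjectionLimit`, fed by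
   `xxz_sector_perron_pos`: the positive sector ground state overlaps `𝟙_W`); by closedness of
   «`0` or occupation-stable» (`coneSel_isClosed_zero_or_stable`, multivariate Hurwitz) `a + u·b` is
   occupation-stable for every `u ∈ ℍ` (`occStable_pair_of_limit`).
4. **Real combinations** `αa + βb` are limits `u → β/α + i0⁺` (resp. `u = i/ε`, `ε → 0⁺`) of such
   vectors, hence `0` or occupation-stable (`zero_or_occStable_real_comb`) — this is exactly the
   orientation- and phase-free `InProperPositionUpToPhase` of the typed statement.
5. **Uniqueness** of the sector ground state on a connected graph (`xxz_sector_perron_pos`) identifies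
   `a, b` with non-zero multiples of the given `ψ, φ`; the inversion `z ↦ −z⁻¹`
   (`ampPoly_eq_prod_mul_occSum`) translates occupation-stability into stability of `ampPoly`.

Main theorem: `xxzTowerProperPosition_holds : XXZTowerProperPosition`.  With A-STAB
(`xxzGroundStateAmplitudeStable_holds`) and E-CONV (`xxzSectorEnergyConvex_holds`) this closes the
spin-½ stability layer of memo ROTOR-THEORY-6 §63–§67 in the tree.  Theory seat
`hubbard-h0-rotor-theory-1`; J. Borcea, P. Brändén, Invent. Math. 177 (2009) §2.2 (elementary
symmetric polynomials are stable).  No definition is introduced.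
-/

set_option linter.dupNamespace false

noncomputable section

namespace Summit.HubbardSuperconductivity.HubbardSuperconductivity.Theorems.AnisotropyChord

open Matrix Complex Finset Filter Topology
open scoped ComplexOrder
open Literature.MathematicalPhysics.QuantumLattice Literature.Probability.LatticeModels

section Helpers

variable {V : Type} [Fintype V] [DecidableEq V]

/-! ### The XXZ ingredients: flow of the initial pair, sector ground projections -/

/-- **Step 2 (flow):** for `|Δ| ≤ 1`, `t ≥ 0`, `u ∈ ℍ` and `W + 1 ≤ n`, the vector
`e^{−tH}𝟙_W + u·e^{−tH}𝟙_{W+1}` has a stable occupation polynomial (S2 applied to `𝟙_W + u·𝟙_{W+1}`).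
[folklore] -/
theorem gibbs_indPair_occStable (G : SimpleGraph V) [DecidableRel G.Adj] {Δ : ℝ} (hΔ : |Δ| ≤ 1)
    {t : ℝ} (ht : 0 ≤ t) {W : ℕ} (hW : W + 1 ≤ Fintype.card V) {u : ℂ} (hu : 0 < u.im) :
    ∀ z : V → ℂ, (∀ i, 0 < (z i).im) →
      (∑ S : Finset V,
        (NormedSpace.exp (-(t : ℂ) • xxzHamiltonian 1 G (-1) Δ) *ᵥ
            (fun σ : V → Fin 2 => if (Finset.univ.filter fun x => σ x = 1).card = W then (1 : ℂ) else 0) +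
          u • (NormedSpace.exp (-(t : ℂ) • xxzHamiltonian 1 G (-1) Δ) *ᵥ
            (fun σ : V → Fin 2 =>
              if (Finset.univ.filter fun x => σ x = 1).card = W + 1 then (1 : ℂ) else 0)))
          (fun i => if i ∈ S then 0 else 1) * ∏ i ∈ S, z i) ≠ 0 := by
  have h := xxz_gibbs_preserves_occStable G hΔ ht _ (fun z hz => occ_indPair_ne_zero hW hu hz)
  rwa [mulVec_add, mulVec_smul] at h

/-- **Step 3 (sectorwise power method) for a sector indicator:** on a connected graph, for an attained
weight `W`, the rescaled flow `e^{tE_W} e^{−tH} 𝟙_W` converges to a NON-ZERO vector `a` of the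
weight-`W` sector with `H a = E_W a`. [folklore] -/
theorem sector_groundProjection (G : SimpleGraph V) [DecidableRel G.Adj] (hG : G.Connected) (Δ : ℝ)
    (W : ℕ) (hW : ∃ σ : V → Fin 2, (∑ z, (σ z : ℕ)) = W) :
    ∃ a : TensorIndex V 2 → ℂ,
      a ∈ spinZSector (Λ := V) 1 (((Fintype.card V * 1 : ℕ) : ℝ) / 2 - W) ∧ a ≠ 0 ∧
      xxzHamiltonian 1 G (-1) Δ *ᵥ a =
        ((lowestEnergyInSector 1 (xxzHamiltonian 1 G (-1) Δ)
          (((Fintype.card V * 1 : ℕ) : ℝ) / 2 - W) : ℝ) : ℂ) • a ∧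
      Tendsto (fun t : ℝ => ((Real.exp (t * lowestEnergyInSector 1 (xxzHamiltonian 1 G (-1) Δ)
          (((Fintype.card V * 1 : ℕ) : ℝ) / 2 - W)) : ℝ) : ℂ) •
        (NormedSpace.exp (-(t : ℂ) • xxzHamiltonian 1 G (-1) Δ) *ᵥ
          (fun σ : V → Fin 2 => if (Finset.univ.filter fun x => σ x = 1).card = W then (1 : ℂ) else 0)))
        atTop (𝓝 a) := by
  set H := xxzHamiltonian 1 G (-1) Δ with hHdef
  have hH : H.IsHermitian := xxzHamiltonian_isHermitian 1 G (-1) Δ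
  set K := spinZSector (Λ := V) 1 (((Fintype.card V * 1 : ℕ) : ℝ) / 2 - W) with hKdef
  set ind : (V → Fin 2) → ℂ :=
    fun σ => if (Finset.univ.filter fun x => σ x = 1).card = W then (1 : ℂ) else 0 with hind
  have hK : ∀ x ∈ K, H *ᵥ x ∈ K := fun x hx => xxz_mulVec_mem_weightSector G Δ W hx
  set E := lowestEnergyInSector 1 H (((Fintype.card V * 1 : ℕ) : ℝ) / 2 - W) with hEdef
  have hE : ∀ x ∈ K, E * (star x ⬝ᵥ x).re ≤ (star x ⬝ᵥ H *ᵥ x).re :=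
    fun x hx => minEnergyOn_mul_le_re_rayleigh hH K hx
  obtain ⟨w, hwK, hw0, hwnn, hwpos, hwoff, hHw, -⟩ := xxz_sector_perron_pos G hG Δ W hW
  have hindK : ind ∈ K := ind_mem_weightSector (V := V) W
  have hind_apply : ∀ σ, ind σ = if (∑ z, (σ z : ℕ)) = W then 1 else 0 := by
    intro σ; simp only [hind, weight_eq_card_filter]
  -- `⟨w, 𝟙_W⟩ ≠ 0`
  have hwv : star w ⬝ᵥ ind ≠ 0 := by
    obtain ⟨σ₀, hσ₀⟩ := hW
    have hsum : star w ⬝ᵥ ind = ∑ σ, star (w σ) * ind σ := rfl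
    have hre : (star w ⬝ᵥ ind).re = ∑ σ, (if (∑ z, (σ z : ℕ)) = W then (w σ).re else 0) := by
      rw [hsum, Complex.re_sum]
      refine Finset.sum_congr rfl fun σ _ => ?_
      rw [hind_apply]
      split_ifs with h
      · rw [mul_one, Complex.star_def, Complex.conj_re]
      · rw [mul_zero, Complex.zero_re]
    intro h0
    have h1 : (star w ⬝ᵥ ind).re = 0 := by rw [h0, Complex.zero_re]
    rw [hre] at h1
    have hle : ∀ σ ∈ (Finset.univ : Finset (V → Fin 2)),
        0 ≤ (if (∑ z, (σ z : ℕ)) = W then (w σ).re else 0) := by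
      intro σ _; split_ifs
      · exact (hwnn σ).1
      · exact le_rfl
    have h2 := (Finset.sum_eq_zero_iff_of_nonneg hle).1 h1 σ₀ (Finset.mem_univ _)
    rw [if_pos hσ₀] at h2
    exact (hwpos σ₀ hσ₀).ne' h2
  have hflowK : ∀ t : ℝ, 0 ≤ t → NormedSpace.exp (-(t : ℂ) • H) *ᵥ ind ∈ K :=
    fun t ht => (gibbs_structure G Δ ht).2 _ _ hindK
  obtain ⟨a, haK, ha0, hHa, hlim⟩ :=
    groundProjection_of_groundOverlap H hH K hK E hE w hHw ind hindK hwv hflowK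
  exact ⟨a, haK, ha0, hHa, hlim⟩

/-- Vectors of different weight sectors are independent: `a + u·b ≠ 0` for `a ≠ 0` of weight `W` and
`b` of weight `W + 1`. [folklore] -/
theorem add_smul_ne_zero_of_sectors {W : ℕ} {a b : TensorIndex V 2 → ℂ}
    (ha : a ∈ spinZSector (Λ := V) 1 (((Fintype.card V * 1 : ℕ) : ℝ) / 2 - W)) (ha0 : a ≠ 0)
    (hb : b ∈ spinZSector (Λ := V) 1 (((Fintype.card V * 1 : ℕ) : ℝ) / 2 - ((W + 1 : ℕ) : ℝ)))
    (u : ℂ) : a + u • b ≠ 0 := by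
  obtain ⟨σ, hσ⟩ := Function.ne_iff.mp ha0
  rw [LiebMattis.mem_spinZSector_weight_iff] at ha hb
  have hσW : (∑ z, (σ z : ℕ)) = W := by
    by_contra h
    exact hσ (ha σ h)
  have hbσ : b σ = 0 := hb σ (by rw [hσW]; omega)
  intro h0
  have := congrFun h0 σ
  rw [Pi.add_apply, Pi.smul_apply, hbσ, smul_zero, add_zero] at this
  exact hσ this

end Helpers

/-! ### The theorem -/

/-- **THEOREM T-INT holds** (memo ROTOR-THEORY-6 §65): on every finite connected graph and for every
`Δ ∈ [−1, 1]`, the ground states `ψ`, `φ` of adjacent sectors `M`, `M − 1` of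
`H(Δ) = xxzHamiltonian 1 G (−1) Δ` have amplitude polynomials in proper position up to phases — every
real combination `α c·a_ψ + β d·a_φ` (for suitable non-zero `c, d`) is stable or vanishes on `ℍ^V`.
Proof: steps 1–5 of the module docstring (elementary symmetric initial pair on `Option V`, S2 flow,
sectorwise power method, closedness, sector Perron–Frobenius uniqueness, inversion). [folklore] -/
theorem xxzTowerProperPosition_holds : XXZTowerProperPosition := by
  intro V _ _ G _ hG M Δ h1 h2 ψ φ hψ hφ
  obtain ⟨hψK, hψ1, hHψ⟩ := hψ
  obtain ⟨hφK, hφ1, hHφ⟩ := hφ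
  have hψ0 : ψ ≠ 0 := by
    intro h; rw [h, dotProduct_zero] at hψ1; exact zero_ne_one hψ1
  have hφ0 : φ ≠ 0 := by
    intro h; rw [h, dotProduct_zero] at hφ1; exact zero_ne_one hφ1
  have hΔ : |Δ| ≤ 1 := abs_le.mpr ⟨h1, h2⟩
  -- the weights: `M = n/2 − W`, `M − 1 = n/2 − (W+1)`
  obtain ⟨W, hWatt, hMW⟩ := exists_weight_of_mem_spinZSector hψK hψ0
  obtain ⟨W', hW'att, hMW'⟩ := exists_weight_of_mem_spinZSector hφK hφ0
  have hW' : W' = W + 1 := by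
    have h : (W' : ℝ) = (W : ℝ) + 1 := by linarith
    exact_mod_cast h
  subst hW'
  have hWn : W + 1 ≤ Fintype.card V := by
    obtain ⟨σ, hσ⟩ := hW'att
    rw [← hσ, weight_eq_card_filter]
    exact (Finset.card_filter_le _ _).trans (Finset.card_univ (α := V)).le
  set n : ℕ := Fintype.card V with hn
  set H := xxzHamiltonian 1 G (-1) Δ with hHdef
  have hM1 : M - 1 = ((Fintype.card V * 1 : ℕ) : ℝ) / 2 - ((W + 1 : ℕ) : ℝ) := hMW'
  rw [hMW] at hψK hHψ
  rw [hM1] at hφK hHφ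
  -- sector ground projections `a` (weight `W`) and `b` (weight `W+1`)
  obtain ⟨a, haK, ha0, hHa, hAlim⟩ := sector_groundProjection G hG Δ W hWatt
  obtain ⟨b, hbK, hb0, hHb, hBlim⟩ := sector_groundProjection G hG Δ (W + 1) hW'att
  set E₀ : ℝ := lowestEnergyInSector 1 H (((Fintype.card V * 1 : ℕ) : ℝ) / 2 - W) with hE₀
  set E₁ : ℝ := lowestEnergyInSector 1 H (((Fintype.card V * 1 : ℕ) : ℝ) / 2 - ((W + 1 : ℕ) : ℝ))
    with hE₁
  -- Steps 2–3: `a + u·b` is occupation-stable for every `u ∈ ℍ`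
  have hpair : ∀ u : ℂ, 0 < u.im → ∀ z : V → ℂ, (∀ i, 0 < (z i).im) →
      (∑ S : Finset V, (a + u • b) (fun i => if i ∈ S then 0 else 1) * ∏ i ∈ S, z i) ≠ 0 := by
    refine occStable_pair_of_limit hAlim hBlim ?_ (fun u _ => add_smul_ne_zero_of_sectors haK ha0 hbK u)
    intro u hu t ht z hz
    -- rescale: `e^{tE₀}X + u e^{tE₁}Y = e^{tE₀} • (X + (u e^{tE₁}/e^{tE₀}) • Y)`
    set c₀ : ℂ := ((Real.exp (t * E₀) : ℝ) : ℂ) with hc₀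
    set c₁ : ℂ := ((Real.exp (t * E₁) : ℝ) : ℂ) with hc₁
    have hc₀ne : c₀ ≠ 0 := Complex.ofReal_ne_zero.mpr (Real.exp_pos _).ne'
    set u' : ℂ := u * c₁ / c₀ with hu'
    have hu'im : 0 < u'.im := by
      rw [hu', hc₀, hc₁, mul_div_assoc, ← Complex.ofReal_div, Complex.mul_im, Complex.ofReal_re,
        Complex.ofReal_im, mul_zero, zero_add]
      exact mul_pos hu (div_pos (Real.exp_pos _) (Real.exp_pos _))
    have heq : c₀ • (NormedSpace.exp (-(t : ℂ) • H) *ᵥ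
          (fun σ : V → Fin 2 => if (Finset.univ.filter fun x => σ x = 1).card = W then (1 : ℂ) else 0)) +
        u • (c₁ • (NormedSpace.exp (-(t : ℂ) • H) *ᵥ
          (fun σ : V → Fin 2 =>
            if (Finset.univ.filter fun x => σ x = 1).card = W + 1 then (1 : ℂ) else 0))) =
        c₀ • ((NormedSpace.exp (-(t : ℂ) • H) *ᵥ
          (fun σ : V → Fin 2 => if (Finset.univ.filter fun x => σ x = 1).card = W then (1 : ℂ) else 0)) +
          u' • (NormedSpace.exp (-(t : ℂ) • H) *ᵥ
          (fun σ : V → Fin 2 =>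
            if (Finset.univ.filter fun x => σ x = 1).card = W + 1 then (1 : ℂ) else 0))) := by
      rw [smul_add, smul_smul, smul_smul]
      congr 2
      rw [hu']
      field_simp
    rw [heq, occ_smul]
    exact mul_ne_zero hc₀ne (gibbs_indPair_occStable G hΔ ht hWn hu'im z hz)
  -- Step 5: identify `a, b` with multiples of `ψ, φ` (sector Perron–Frobenius uniqueness)
  obtain ⟨ψ₀, hψ₀K, hψ₀0, -, -, -, hHψ₀, huniq₀⟩ := xxz_sector_perron_pos G hG Δ W hWatt
  obtain ⟨ψ₁, hψ₁K, hψ₁0, -, -, -, hHψ₁, huniq₁⟩ := xxz_sector_perron_pos G hG Δ (W + 1) hW'att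
  obtain ⟨ca, hca⟩ := huniq₀ a haK hHa
  obtain ⟨cψ, hcψ⟩ := huniq₀ ψ hψK hHψ
  obtain ⟨cb, hcb⟩ := huniq₁ b hbK hHb
  obtain ⟨cφ, hcφ⟩ := huniq₁ φ hφK hHφ
  have hcψ0 : cψ ≠ 0 := by intro h; rw [h, zero_smul] at hcψ; exact hψ0 hcψ
  have hcφ0 : cφ ≠ 0 := by intro h; rw [h, zero_smul] at hcφ; exact hφ0 hcφ
  have hca0 : ca ≠ 0 := by intro h; rw [h, zero_smul] at hca; exact ha0 hca
  have hcb0 : cb ≠ 0 := by intro h; rw [h, zero_smul] at hcb; exact hb0 hcb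
  -- `a = κ • ψ`, `b = κ' • φ`
  set κ : ℂ := ca * cψ⁻¹ with hκ
  set κ' : ℂ := cb * cφ⁻¹ with hκ'
  have haψ : a = κ • ψ := by
    rw [hκ, hca, ← smul_smul, hcψ, smul_smul cψ⁻¹, inv_mul_cancel₀ hcψ0, one_smul]
  have hbφ : b = κ' • φ := by
    rw [hκ', hcb, ← smul_smul, hcφ, smul_smul cφ⁻¹, inv_mul_cancel₀ hcφ0, one_smul]
  have hκ0 : κ ≠ 0 := mul_ne_zero hca0 (inv_ne_zero hcψ0)
  have hκ'0 : κ' ≠ 0 := mul_ne_zero hcb0 (inv_ne_zero hcφ0)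
  -- supports (for the inversion identity)
  have hsuppψ : ∀ σ : TensorIndex V 2, (∑ x, (σ x : ℕ)) ≠ W → ψ σ = 0 :=
    (LiebMattis.mem_spinZSector_weight_iff 1 W ψ).1 hψK
  have hsuppφ : ∀ σ : TensorIndex V 2, (∑ x, (σ x : ℕ)) ≠ W + 1 → φ σ = 0 :=
    (LiebMattis.mem_spinZSector_weight_iff 1 (W + 1) φ).1 hφK
  have hsign : ((-1 : ℂ)) ^ (Fintype.card V - W) = -((-1 : ℂ) ^ (Fintype.card V - (W + 1))) := by
    have : Fintype.card V - W = (Fintype.card V - (W + 1)) + 1 := by omega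
    rw [this, pow_succ]; ring
  -- the proper-position witnesses: `c = κ`, `d = −κ'`
  refine ⟨κ, -κ', hκ0, neg_ne_zero.mpr hκ'0, fun α β => ?_⟩
  -- the key identity: `α κ a_ψ(z) + β (−κ') a_φ(z) = (Π z) (−1)^{n−W} occ_{αa+βb}(−z⁻¹)`
  have hkey : ∀ z : V → ℂ, (∀ x, z x ≠ 0) →
      (α : ℂ) * (κ * ampPoly ψ z) + (β : ℂ) * (-κ' * ampPoly φ z) =
        (∏ x, z x) * (-1) ^ (Fintype.card V - W) *
          ∑ S : Finset V, ((α : ℂ) • a + (β : ℂ) • b) (fun i => if i ∈ S then 0 else 1) *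
            ∏ i ∈ S, (-(z i)⁻¹) := by
    intro z hz
    rw [ampPoly_eq_prod_mul_occSum ψ hsuppψ z hz, ampPoly_eq_prod_mul_occSum φ hsuppφ z hz, haψ, hbφ,
      smul_smul, smul_smul, occ_add_smul, hsign]
    ring
  rcases zero_or_occStable_real_comb hpair α β with h0 | hst
  · -- the combination vanishes identically
    right
    intro z hz
    have hzne : ∀ x, z x ≠ 0 := fun x h => (hz x).ne' (by rw [h, Complex.zero_im])
    rw [hkey z hzne, h0]
    simp
  · left
    intro z hz
    have hzne : ∀ x, z x ≠ 0 := fun x h => (hz x).ne' (by rw [h, Complex.zero_im])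
    show (α : ℂ) * (κ * ampPoly ψ z) + (β : ℂ) * (-κ' * ampPoly φ z) ≠ 0
    rw [hkey z hzne]
    refine mul_ne_zero (mul_ne_zero (Finset.prod_ne_zero_iff.mpr fun x _ => hzne x)
      (pow_ne_zero _ (neg_ne_zero.mpr one_ne_zero))) ?_
    exact hst (fun x => -(z x)⁻¹)
      (fun x => Literature.Combinatorics.StablePolynomials.neg_inv_im_pos (hz x))

end Summit.HubbardSuperconductivity.HubbardSuperconductivity.Theorems.AnisotropyChord
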